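/-
Copyright: cell pub-balaban-gaps (YM BLITZ Y1, track G1), seat g1-p2 GEN 6 (unit `pub-balaban-gaps-g1-p2`).  Row (D4) NODE O,
OBJECT ∕ MECHANISM level: the PRODUCER of an s-DECORATED exponential tail as a block walk expansion (the input of file 49's
`blockWalkExpansion_tail_bwe`), print's power-one decoration ([II] p. 3, (1.11) p. 5) applied to the tail split into block pairs.
Residue R49-1 of planner g1-plan-1 GEN 17 ([G1-PLAN1-G17-XREAD-49]; reading copy: skeleton #18
`pub-balaban-gaps-g1-plan-1/skel18_R49_1_decoration_absorption.NOT-TO-FILE.lean` b4a6507e447f12ba — the absorption step; credited,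
here realised through the LANDED `Gaps/D4WalkBlockDecorate.blockWalkExpansion_decorate` (file 38), whose window shift keeps the
majorant sum).  HONEST FRAMING: bookkeeping over hypothesis SHAPES (one decaying block letter for the tail + decoration ∕ tube letters);
nothing of Bałaban's constructed or asserted; (D4) NOT discharged (instance 0∕1); NOT BetaPertH, NOT continuum, NOT Clay.
-/
import Summits.QuantumFields.BalabanUV.Gaps.D4WalkBlockDecorate
import Summits.QuantumFields.BalabanUV.Gaps.D4WalkBlockReroute

/-!
# `Gaps.D4WalkBlockTailDecorated` — the exponential tail, split into block pairs and s-decorated along a tube, is a block walk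
# expansion at the shifted rate `ρ_V − κ₁P₁` (cell pub-balaban-gaps, seat g1-p2 GEN 6)

HONEST DEPENDENCY (cell pub-balaban, verbatim): continuum YM on T⁴ ⇐ BetaPertH ∧ nine spine estimates (0/9 proved);
BetaPertH ⇐ (D1) ∧ (D4) ∧ CAP+tail.

WHY.  File 49 (`Gaps/D4WalkBlockTail`) resums a perturbation `V` of the operator on top of a block walk expansion `W(s,u)`; its general
form `blockWalkExpansion_tail_bwe` CONSUMES a block walk expansion of `V`, possibly s-decorated.  In print EVERY term carries its
monomial of decoupling parameters ([II] p. 3 *«we take {Δ₁,…,Δ_m} of all cubes from σ₀ which intersect this localization domain, and we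
multiply the term … by Π s(Δ_j)»*, (1.11) p. 5 *«m is the number of the parameters s connected with the walk ω»*); a σ-INDEPENDENT tail
(49's `blockWalkExpansion_tail`) interpolates differently (planner g1-plan-1's residue R49-1).  THIS FILE PRODUCES the decorated tail:
* §1 `blockCut` (the `(a,b)` block of a matrix), `hasSum_blockCut` (the blocks resum the matrix), `blockNorm_blockCut_le`,
  `differentiableOn_blockCut`; `sum_exp_triangle_le` (one cube row-sum convolution along the triangle inequality);
* §2 `blockWalkExpansion_pairs`: a σ-independent holomorphic family with ONE decaying block letter `λe^{−ρ_Vd₁}`, SPLIT INTO BLOCK PAIRS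
  `(a,b)`, is a block walk expansion with walk distances `D_{(a,b)}(y,y′) = d₁(y,a) + d₁(a,b) + d₁(b,y′)` (a one-jump walk), amplitudes `λ`,
  constant `λc_μ²`, torus rate `κ ≤ ρ_V − ε − 2μ`, no σ-carrying term;
* §3 **`blockWalkExpansion_tail_decorated`**: with decoration data per pair — parameter sets `decV (a,b)` (print: the cubes of `σ₀` met
  by the jump's localization tube), the NEAR letter «`decV (a,b) ≠ ∅` ⟹ some `z ∈ X` with `d₁(a,z) + d₁(z,b) ≤ d₁(a,b) + s`» and the TUBE
  letter `#decV (a,b) ≤ P₀ + P₁·d₁(a,b)` ((1.11): «δ₀d(ω) ≥ δ₁mM»), shift `κ₁P₁ ≤ ε` — route once per pair (42's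
  `blockWalkExpansion_reroute`, slack `s`) and decorate once per parameter (38's `blockWalkExpansion_decorate`): the family
  `(a,b) ↦ (Π_{j ∈ decV(a,b)} s_j)·V(u)_{(a,b)}` is a block walk expansion at window `ε − κ₁P₁`, rate `ρ_V − κ₁P₁`, constant
  `e^{κ₁P₀}·e^{εs}·λc_μ²`, σ-region `X`, σ-carrying pairs = the decorated ones, dominating distances; at `s ≡ 1` its kernel is `V(u)`
  (38's `kernel_decorate_one` + §1) — ready for 49's `blockWalkExpansion_tail_bwe` (nesting: `ρ_W + μ ≤ ρ_V − κ₁P₁`);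
* §3′ `endpointDec` ∕ **`blockWalkExpansion_tail_decorated_endpoint`**: the ENDPOINT decoration (parameter cells of the `X`-cubes within
  `R_b` of the jump's start) satisfies NEAR (slack `2R_b`) and TUBE (`P₀ = P`, `P₁ = 0`) from 44's packing letter `hpack` ALONE — the
  decorated tail then asks NO geometric letter beyond the one-scale END's own decoration data, and no rate shift; and
  `card_ball_le_of_rowSum` ∕ **`hpack_of_rowSum`** (planner g1-plan-1's skeleton #19, credited): the packing letter itself follows
  from the cube row sum, `P = ⌈c_μe^{μR_b}⌉₊`.
WHAT IT IS NOT: the decoration ∕ tube data for Bałaban's tail (a geodesic-tube construction on the cube torus and the count `P` per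
`r₀`) are hypotheses here, as 44's packing letters are; print's own tail terms come from (3.95)–(3.96) through the fine-lattice walks,
not from a resummed letter — a MODEL interpolation either way; (D4) instance 0∕1; words UNCHANGED.

References: T. Bałaban, Comm. Math. Phys. 116 (1988) 1–22 [II], p.3, (1.11) p.5, p.13, p.15; Comm. Math. Phys. 99 (1985) 389–434
[B9], Thm 3.2 (3.48) p.398, (3.95)–(3.96) p.411, Thm 3.10 (3.107)–(3.108) p.416, (3.154) p.427.
-/

noncomputable section

namespace Summit.QuantumFields.BalabanUV.Gaps.D4WalkBlockTailDecorated

open Metric Set Finset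
open Literature.MathematicalPhysics.QuantumFieldTheory.Balaban1983to89
open Literature.MathematicalPhysics.QuantumFieldTheory.Balaban1983to89.B9SectDWalk (Through MajSumLe DomBy)
open Literature.MathematicalPhysics.QuantumFieldTheory.Balaban1983to89.B9Thm34Ext (toB6)
open Literature.MathematicalPhysics.QuantumFieldTheory.Balaban1983to89.B9Thm37GlueTorus
  (torusGeom tdist1 tdist1_nonneg tdist1_self tdist1_triangle tdist1_comm)
open Literature.MathematicalPhysics.QuantumFieldTheory.Balaban1983to89.TreeLengthTorus (TPt)
open Literature.MathematicalPhysics.QuantumFieldTheory.Balaban1983to89.B5TorusCover (UT)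
open Literature.MathematicalPhysics.QuantumFieldTheory.Balaban1983to89.B11SectG (RowSum)
open Summit.QuantumFields.BalabanUV.Gaps.D4WalkBlock
  (rowMass blockNorm blockNorm_nonneg rowMass_le_blockNorm blockNorm_le_of_rowMass_le BlockWalkExpansion)
open Summit.QuantumFields.BalabanUV.Gaps.D4WalkBlockDecorate (decTerm decKernel blockWalkExpansion_decorate kernel_decorate_one)
open Summit.QuantumFields.BalabanUV.Gaps.D4WalkBlockReroute (blockWalkExpansion_reroute domBy_reroute)

variable {ν : ℕ} {K : Fin ν → ℕ} [∀ i, NeZero (K i)]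
variable {d N' : ℕ} {n : Type} [Fintype n]
variable {E : Type*} [NormedAddCommGroup E] [NormedSpace ℂ E]

/-! ## §1. Block pairs of a matrix; one convolution along the triangle inequality -/

section Cut

/-- The `(a,b)` BLOCK of a matrix: rows in cube `a`, columns in cube `b`, zero elsewhere. -/
def blockCut (cubn : n → UT K) (a b : UT K) (M : Matrix n n ℂ) : Matrix n n ℂ :=
  fun i j => if cubn i = a ∧ cubn j = b then M i j else 0

omit [∀ i, NeZero (K i)] [Fintype n] in
/-- Unfolding of `blockCut`. -/
theorem blockCut_apply (cubn : n → UT K) (a b : UT K) (M : Matrix n n ℂ) (i j : n) :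
    blockCut cubn a b M i j = if cubn i = a ∧ cubn j = b then M i j else 0 := rfl

omit [∀ i, NeZero (K i)] [Fintype n] in
/-- **The blocks resum the matrix**, entrywise as a `HasSum` over the finite pair type (the one-term-per-pair expansion).
[cite: Balaban1985BackgroundPropagators, (3.107) p.416] -/
theorem hasSum_blockCut (cubn : n → UT K) (M : Matrix n n ℂ) (i j : n) :
    HasSum (fun ab : UT K × UT K => blockCut cubn ab.1 ab.2 M i j) (M i j) := by
  classical
  have h := hasSum_fintype (fun ab : UT K × UT K => blockCut cubn ab.1 ab.2 M i j)
  have e : ∑ ab : UT K × UT K, blockCut cubn ab.1 ab.2 M i j = M i j := by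
    have hc : ∀ ab : UT K × UT K, blockCut cubn ab.1 ab.2 M i j = if ab = (cubn i, cubn j) then M i j else 0 := by
      intro ab
      simp only [blockCut_apply]
      by_cases hab : ab = (cubn i, cubn j)
      · subst hab; simp
      · rw [if_neg hab, if_neg]
        rintro ⟨h1, h2⟩
        exact hab (Prod.ext h1.symm h2.symm)
    simp_rw [hc]
    rw [Finset.sum_ite_eq' Finset.univ (cubn i, cubn j)]
    simp
  rwa [e] at h

omit [∀ i, NeZero (K i)] in
/-- The block norm of the `(a,b)` block: the block norm of the matrix at `(a,b)`, zero at every other pair of cubes. -/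
theorem blockNorm_blockCut_le (cubn : n → UT K) (a b : UT K) (M : Matrix n n ℂ) (y y' : UT K) :
    blockNorm cubn cubn (blockCut cubn a b M) y y' ≤ if y = a ∧ y' = b then blockNorm cubn cubn M y y' else 0 := by
  classical
  split_ifs with h
  · refine blockNorm_le_of_rowMass_le cubn cubn _ y y' (blockNorm_nonneg _ _ _ _ _) fun i hi => ?_
    have h1 : rowMass cubn (blockCut cubn a b M) i y' ≤ rowMass cubn M i y' := by
      unfold rowMass
      exact Finset.sum_le_sum fun j _ => by simp only [blockCut_apply]; split_ifs <;> simp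
    have h2 := rowMass_le_blockNorm cubn cubn M i y'
    rw [hi] at h2
    exact h1.trans h2
  · refine blockNorm_le_of_rowMass_le cubn cubn _ y y' le_rfl fun i hi => ?_
    unfold rowMass
    refine Finset.sum_nonpos fun j hj => ?_
    have hy' : cubn j = y' := (Finset.mem_filter.1 hj).2
    have : blockCut cubn a b M i j = 0 := by
      simp only [blockCut_apply]
      rw [if_neg]
      rintro ⟨h1, h2⟩
      exact h ⟨hi ▸ h1, hy' ▸ h2⟩
    rw [this, norm_zero]

omit [∀ i, NeZero (K i)] [Fintype n] in
/-- Entries of the blocks of a holomorphic family are holomorphic. [folklore] -/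
theorem differentiableOn_blockCut (cubn : n → UT K) (a b : UT K) {V : E → Matrix n n ℂ} {R : ℝ}
    (hVan : ∀ i j, DifferentiableOn ℂ (fun u => V u i j) (ball (0 : E) R)) (i j : n) :
    DifferentiableOn ℂ (fun u => blockCut cubn a b (V u) i j) (ball (0 : E) R) := by
  simp only [blockCut_apply]
  split_ifs
  · exact hVan i j
  · exact differentiableOn_const _

/-- **One cube row-sum convolution along the triangle inequality**: `Σ_b e^{−ρ₁d₁(a,b)}e^{−ρ₂d₁(b,y′)} ≤ c_μ·e^{−ρd₁(a,y′)}` for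
`0 ≤ ρ ≤ ρ₂`, `ρ + μ ≤ ρ₁`. [cite: Balaban1985BackgroundPropagators, (3.92)–(3.94) p.410; Balaban1984PropagatorsII, (2.61) p.234] -/
theorem sum_exp_triangle_le {μ cμ ρ ρ₁ ρ₂ : ℝ} (hrow : RowSum (toB6 (torusGeom K 0 0 0) 0 True) μ cμ) (hρ : 0 ≤ ρ)
    (hρ₁ : ρ + μ ≤ ρ₁) (hρ₂ : ρ ≤ ρ₂) (a y' : UT K) :
    ∑ b : UT K, Real.exp (-(ρ₁ * tdist1 K a b)) * Real.exp (-(ρ₂ * tdist1 K b y')) ≤ cμ * Real.exp (-(ρ * tdist1 K a y')) := by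
  have hterm : ∀ b : UT K, Real.exp (-(ρ₁ * tdist1 K a b)) * Real.exp (-(ρ₂ * tdist1 K b y')) ≤
      Real.exp (-(μ * tdist1 K a b)) * Real.exp (-(ρ * tdist1 K a y')) := by
    intro b
    rw [← Real.exp_add, ← Real.exp_add]
    refine Real.exp_le_exp.2 ?_
    have h1 := tdist1_triangle a b y'
    have h2 := tdist1_nonneg a b
    have h3 := tdist1_nonneg b y'
    nlinarith [mul_le_mul_of_nonneg_left h1 hρ, mul_le_mul_of_nonneg_right hρ₂ h3]
  calc ∑ b : UT K, Real.exp (-(ρ₁ * tdist1 K a b)) * Real.exp (-(ρ₂ * tdist1 K b y'))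
      ≤ ∑ b : UT K, Real.exp (-(μ * tdist1 K a b)) * Real.exp (-(ρ * tdist1 K a y')) := Finset.sum_le_sum fun b _ => hterm b
    _ = (∑ b : UT K, Real.exp (-(μ * tdist1 K a b))) * Real.exp (-(ρ * tdist1 K a y')) := by rw [Finset.sum_mul]
    _ ≤ cμ * Real.exp (-(ρ * tdist1 K a y')) := mul_le_mul_of_nonneg_right (hrow a) (Real.exp_nonneg _)

end Cut

/-! ## §2. The tail split into block pairs is a block walk expansion with one-jump walk distances -/

section Pairs

/-- **THE TAIL SPLIT INTO BLOCK PAIRS** is a block walk expansion: terms `(a,b) ↦ V(u)_{(a,b)}`, walk distances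
`D_{(a,b)}(y,y′) = d₁(y,a) + d₁(a,b) + d₁(b,y′)`, amplitudes `λ`, walk rate `ρ_V`, any window `ε ≤ ρ_V`, torus rate `κ` with
`κ + 2μ ≤ ρ_V − ε` (two cube row-sum convolutions), constant `λc_μ²`, no σ-carrying term.
[cite: Balaban1985BackgroundPropagators, Thm 3.2 (3.48) p.398, (3.107)–(3.108) p.416] -/
theorem blockWalkExpansion_pairs (c : B13.Consts) (cubn : n → UT K) (X : Finset (UT K)) {V : E → Matrix n n ℂ}
    {R ε κ lamV ρV μ cμ : ℝ} (hlam : 0 ≤ lamV) (hμ : 0 ≤ μ) (hκ : 0 ≤ κ) (hκε : κ + 2 * μ ≤ ρV - ε)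
    (hrow : RowSum (toB6 (torusGeom K 0 0 0) 0 True) μ cμ)
    (hVan : ∀ i j, DifferentiableOn ℂ (fun u => V u i j) (ball (0 : E) R))
    (hVbd : ∀ u ∈ ball (0 : E) R, ∀ y y', blockNorm cubn cubn (V u) y y' ≤ lamV * Real.exp (-(ρV * tdist1 K y y'))) :
    BlockWalkExpansion c cubn cubn (fun (_ : TPt d N' → ℂ) u => V u) X R ε κ (lamV * cμ * cμ)
      (fun (ab : UT K × UT K) (_ : TPt d N' → ℂ) u => blockCut cubn ab.1 ab.2 (V u)) (∅ : Set (UT K × UT K)) (fun _ => lamV)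
      (fun ab y y' => tdist1 K y ab.1 + tdist1 K ab.1 ab.2 + tdist1 K ab.2 y') ρV := by
  refine
  { hasSum := fun σ _ u _ i j => hasSum_blockCut cubn (V u) i j
    termAnalytic := fun ab σ _ i j => differentiableOn_blockCut cubn ab.1 ab.2 hVan i j
    majB := fun ab σ _ u hu y y' => ?_
    majSum := fun S y y' => ?_
    indep := fun _ _ σ _ => rfl
    through := fun ω hω => by simp at hω
    A_nonneg := fun _ => hlam
    D_nonneg := fun ab y y' => add_nonneg (add_nonneg (tdist1_nonneg _ _) (tdist1_nonneg _ _)) (tdist1_nonneg _ _) }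
  · -- the (a,b) term lives on the block (a,b), where its walk distance is d₁(a,b)
    refine (blockNorm_blockCut_le cubn ab.1 ab.2 (V u) y y').trans ?_
    split_ifs with h
    · obtain ⟨h1, h2⟩ := h
      subst h1; subst h2
      simpa [tdist1_self] using hVbd u hu ab.1 ab.2
    · positivity
  · -- two convolutions: Σ_{(a,b)} λe^{−ρ′(d(y,a)+d(a,b)+d(b,y′))} ≤ λc_μ²e^{−(ρ′−2μ)d(y,y′)} ≤ λc_μ²e^{−κd(y,y′)}
    have hρ' : 0 ≤ ρV - ε - 2 * μ := by linarith
    have hcμ : 0 ≤ cμ := (Finset.sum_nonneg fun _ _ => Real.exp_nonneg _).trans (hrow y)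
    calc ∑ ab ∈ S, lamV * Real.exp (-((ρV - ε) * (tdist1 K y ab.1 + tdist1 K ab.1 ab.2 + tdist1 K ab.2 y')))
        ≤ ∑ ab : UT K × UT K, lamV * Real.exp (-((ρV - ε) * (tdist1 K y ab.1 + tdist1 K ab.1 ab.2 + tdist1 K ab.2 y'))) :=
          Finset.sum_le_sum_of_subset_of_nonneg (Finset.subset_univ S) fun _ _ _ => by positivity
      _ = ∑ a : UT K, ∑ b : UT K, lamV * (Real.exp (-((ρV - ε) * tdist1 K y a)) *
            (Real.exp (-((ρV - ε) * tdist1 K a b)) * Real.exp (-((ρV - ε) * tdist1 K b y')))) := by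
          rw [Fintype.sum_prod_type]
          refine Finset.sum_congr rfl fun a _ => Finset.sum_congr rfl fun b _ => ?_
          rw [← Real.exp_add, ← Real.exp_add]
          congr 1; ring
      _ ≤ ∑ a : UT K, lamV * (Real.exp (-((ρV - ε) * tdist1 K y a)) * (cμ * Real.exp (-((ρV - ε - μ) * tdist1 K a y')))) := by
          refine Finset.sum_le_sum fun a _ => ?_
          rw [← Finset.mul_sum, ← Finset.mul_sum]
          exact mul_le_mul_of_nonneg_left (mul_le_mul_of_nonneg_left
            (sum_exp_triangle_le (ρ := ρV - ε - μ) (ρ₁ := ρV - ε) (ρ₂ := ρV - ε) hrow (by linarith) (by linarith) (by linarith) a y')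
            (Real.exp_nonneg _)) hlam
      _ = lamV * cμ * ∑ a : UT K, Real.exp (-((ρV - ε) * tdist1 K y a)) * Real.exp (-((ρV - ε - μ) * tdist1 K a y')) := by
          rw [Finset.mul_sum]
          exact Finset.sum_congr rfl fun a _ => by ring
      _ ≤ lamV * cμ * (cμ * Real.exp (-((ρV - ε - 2 * μ) * tdist1 K y y'))) :=
          mul_le_mul_of_nonneg_left
            (sum_exp_triangle_le (ρ := ρV - ε - 2 * μ) (ρ₁ := ρV - ε) (ρ₂ := ρV - ε - μ) hrow hρ' (by linarith) (by linarith) y y')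
            (mul_nonneg hlam hcμ)
      _ = (lamV * cμ * cμ) * Real.exp (-((ρV - ε - 2 * μ) * tdist1 K y y')) := by ring
      _ ≤ (lamV * cμ * cμ) * Real.exp (-(κ * tdist1 K y y')) := by
          refine mul_le_mul_of_nonneg_left (Real.exp_le_exp.2 ?_) (by positivity)
          nlinarith [tdist1_nonneg y y']

end Pairs

/-! ## §3. THE PRODUCER: route once per pair, decorate once per parameter -/

section Decorated

variable {c₀ c : B13.Consts} {cubn : n → UT K} {X : Finset (UT K)} {V : E → Matrix n n ℂ}
variable {R ε κ lamV ρV μ cμ s : ℝ}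

/-- **THE s-DECORATED EXPONENTIAL TAIL IS A BLOCK WALK EXPANSION AT THE SHIFTED RATE.**  Data: the tail letters of §2 (at any tag
constants `c₀` with `κ₁(c₀) ≥ 0`); decoration data per block pair — parameter sets `decV (a,b)`, the NEAR letter (a decorated pair's jump
passes within slack `s` of `X`: `∃ z ∈ X, d₁(a,z) + d₁(z,b) ≤ d₁(a,b) + s`) and the TUBE letter `#decV (a,b) ≤ P₀ + P₁·d₁(a,b)`, `0 ≤ P₁`,
and the shift `κ₁P₁ ≤ ε`.  Then the power-one decorated pair family is a `BlockWalkExpansion` at the physical constants `c`: window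
`ε − κ₁P₁`, torus rate `κ`, constant `e^{κ₁P₀}·(e^{εs}·λc_μ²)`, σ-carrying pairs `{decV ≠ ∅}`, amplitudes `e^{κ₁P₀}·λe^{ρ_Vs}`, distances
`D_{(a,b)} + s`, rate `ρ_V − κ₁P₁`; its `s ≡ 1` kernel is `V(u)`; the distances dominate `d₁`.  Composition BY NAME: §2 →
`blockWalkExpansion_reroute` → `blockWalkExpansion_decorate`. [cite: Balaban1988RG2Cluster, p.3, (1.11) p.5, p.13, p.15; Balaban1985BackgroundPropagators, Thm 3.2 (3.48) p.398, (3.107)–(3.108) p.416, (3.154) p.427] -/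
theorem blockWalkExpansion_tail_decorated
    (hκ₁₀ : 0 ≤ c₀.κ₁) (hlam : 0 ≤ lamV) (hμ : 0 ≤ μ) (hκ : 0 ≤ κ) (hκε : κ + 2 * μ ≤ ρV - ε)
    (hrow : RowSum (toB6 (torusGeom K 0 0 0) 0 True) μ cμ)
    (hVan : ∀ i j, DifferentiableOn ℂ (fun u => V u i j) (ball (0 : E) R))
    (hVbd : ∀ u ∈ ball (0 : E) R, ∀ y y', blockNorm cubn cubn (V u) y y' ≤ lamV * Real.exp (-(ρV * tdist1 K y y')))
    -- decoration data
    (decV : UT K × UT K → Finset (TPt d N')) (hs : 0 ≤ s)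
    (hnear : ∀ ab, (decV ab).Nonempty → ∃ z ∈ X, tdist1 K ab.1 z + tdist1 K z ab.2 ≤ tdist1 K ab.1 ab.2 + s)
    {P₀ P₁ : ℝ} (hP₁ : 0 ≤ P₁) (htube : ∀ ab, ((decV ab).card : ℝ) ≤ P₀ + P₁ * tdist1 K ab.1 ab.2)
    (hκ₁ : 0 ≤ c.κ₁) (hshift : c.κ₁ * P₁ ≤ ε) :
    BlockWalkExpansion c cubn cubn
        (decKernel (fun (ab : UT K × UT K) (_ : TPt d N' → ℂ) u => blockCut cubn ab.1 ab.2 (V u)) decV) X R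
        (ε - c.κ₁ * P₁) κ (Real.exp (c.κ₁ * P₀) * (Real.exp (ε * s) * (lamV * cμ * cμ)))
        (decTerm (fun (ab : UT K × UT K) (_ : TPt d N' → ℂ) u => blockCut cubn ab.1 ab.2 (V u)) decV)
        {ab | (decV ab).Nonempty} (fun _ => Real.exp (c.κ₁ * P₀) * (lamV * Real.exp (ρV * s)))
        (fun ab y y' => tdist1 K y ab.1 + tdist1 K ab.1 ab.2 + tdist1 K ab.2 y' + s) (ρV - c.κ₁ * P₁) ∧
      (∀ u ∈ ball (0 : E) R,
        decKernel (fun (ab : UT K × UT K) (_ : TPt d N' → ℂ) u => blockCut cubn ab.1 ab.2 (V u)) decV (fun _ => 1) u = V u) ∧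
      ∀ ab : UT K × UT K, DomBy (toB6 (torusGeom K 0 0 0) 0 True)
        (fun y y' => tdist1 K y ab.1 + tdist1 K ab.1 ab.2 + tdist1 K ab.2 y' + s) := by
  -- (i) the untagged pair expansion at the tag constants
  have hP := blockWalkExpansion_pairs (d := d) (N' := N') c₀ cubn X hlam hμ hκ hκε hrow hVan hVbd
  have hdom : ∀ ab : UT K × UT K, DomBy (toB6 (torusGeom K 0 0 0) 0 True)
      (fun y y' => tdist1 K y ab.1 + tdist1 K ab.1 ab.2 + tdist1 K ab.2 y') := fun ab y y' => by
    have h1 := tdist1_triangle y ab.1 y'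
    have h2 := tdist1_triangle ab.1 ab.2 y'
    show tdist1 K y y' ≤ tdist1 K y ab.1 + tdist1 K ab.1 ab.2 + tdist1 K ab.2 y'
    linarith
  -- (ii) route ONCE per pair: a decorated pair's one-jump walk passes within `s` of X
  have hre := blockWalkExpansion_reroute hP {ab | (decV ab).Nonempty} X hs (fun _ _ σ _ => rfl)
    (fun ab hab y y' => by
      obtain ⟨z, hz, hzle⟩ := hnear ab hab
      refine ⟨z, hz, ?_⟩
      have h1 := tdist1_triangle y ab.1 z
      have h2 := tdist1_triangle z ab.2 y'
      linarith)
  -- (iii) decorate ONCE per parameter under the tube letter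
  refine ⟨blockWalkExpansion_decorate hre hκ₁₀ hκ₁ decV (fun ab hab => hab) (P₀ := P₀) (P₁ := P₁)
    (fun ab u _ y y' hne => ?_) hshift, fun u hu => ?_, fun ab => domBy_reroute hdom hs ab⟩
  · -- a non-zero block of the (a,b) term sits at (y,y′) = (a,b), where the distance is d₁(a,b) + s
    have hb := blockNorm_blockCut_le cubn ab.1 ab.2 (V u) y y'
    by_cases hyy : y = ab.1 ∧ y' = ab.2
    · obtain ⟨h1, h2⟩ := hyy
      subst h1; subst h2
      rw [tdist1_self, tdist1_self, zero_add, add_zero]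
      have := htube ab
      have hd := tdist1_nonneg ab.1 ab.2
      nlinarith
    · rw [if_neg hyy] at hb
      exact absurd (le_antisymm hb (blockNorm_nonneg _ _ _ _ _)) hne
  · have h := kernel_decorate_one hre hκ₁₀ decV u hu
    simpa using h

/-- **Chebyshev from the cube row sum**: `#{z : d₁(a,z) ≤ R}·e^{−μR} ≤ Σ_z e^{−μd₁(a,z)} ≤ c_μ` (planner g1-plan-1 GEN 17's skeleton #19
`card_ball_le_of_rowSum`, credited; re-typed here). [folklore] -/
theorem card_ball_le_of_rowSum {μ cμ : ℝ} (hrow : RowSum (toB6 (torusGeom K 0 0 0) 0 True) μ cμ) (hμ : 0 ≤ μ) (a : UT K)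
    (Rb : ℝ) : ((Finset.univ.filter fun z : UT K => tdist1 K a z ≤ Rb).card : ℝ) ≤ cμ * Real.exp (μ * Rb) := by
  have h1 : ((Finset.univ.filter fun z : UT K => tdist1 K a z ≤ Rb).card : ℝ) * Real.exp (-(μ * Rb)) ≤
      ∑ z ∈ Finset.univ.filter (fun z : UT K => tdist1 K a z ≤ Rb), Real.exp (-(μ * tdist1 K a z)) := by
    rw [← nsmul_eq_mul, ← Finset.sum_const]
    exact Finset.sum_le_sum fun z hz => Real.exp_le_exp.2 (by
      have := (Finset.mem_filter.1 hz).2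
      nlinarith)
  have h2 : ∑ z ∈ Finset.univ.filter (fun z : UT K => tdist1 K a z ≤ Rb), Real.exp (-(μ * tdist1 K a z)) ≤ cμ :=
    (Finset.sum_le_sum_of_subset_of_nonneg (Finset.filter_subset _ _) fun _ _ _ => Real.exp_nonneg _).trans (hrow a)
  have h3 : Real.exp (-(μ * Rb)) * Real.exp (μ * Rb) = 1 := by rw [← Real.exp_add, neg_add_cancel, Real.exp_zero]
  calc ((Finset.univ.filter fun z : UT K => tdist1 K a z ≤ Rb).card : ℝ)
      = ((Finset.univ.filter fun z : UT K => tdist1 K a z ≤ Rb).card : ℝ) * Real.exp (-(μ * Rb)) * Real.exp (μ * Rb) := by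
        rw [mul_assoc, h3, mul_one]
    _ ≤ cμ * Real.exp (μ * Rb) := mul_le_mul_of_nonneg_right (h1.trans h2) (Real.exp_nonneg _)

/-- **44's PACKING LETTER FROM THE CUBE ROW SUM** (skeleton #19's `hpack_of_rowSum`, credited): for ANY `cellOf`, the cells of the
`R_b`-ball pack with `P = ⌈c_μe^{μR_b}⌉₊` — one instance letter fewer for every END of the chain (44 ∕ 45 ∕ 47 ∕ 50 ∕ 52). [folklore] -/
theorem hpack_of_rowSum {μ cμ : ℝ} (hrow : RowSum (toB6 (torusGeom K 0 0 0) 0 True) μ cμ) (hμ : 0 ≤ μ)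
    (cellOf : UT K → TPt d N') (Rb : ℝ) :
    ∀ a : UT K, ∃ S : Finset (TPt d N'), S.card ≤ ⌈cμ * Real.exp (μ * Rb)⌉₊ ∧ ∀ z, tdist1 K a z ≤ Rb → cellOf z ∈ S := by
  classical
  intro a
  refine ⟨(Finset.univ.filter fun z : UT K => tdist1 K a z ≤ Rb).image cellOf, ?_, fun z hz =>
    Finset.mem_image_of_mem cellOf (Finset.mem_filter.2 ⟨Finset.mem_univ z, hz⟩)⟩
  have h := (Nat.cast_le.2 (Finset.card_image_le (s := Finset.univ.filter fun z : UT K => tdist1 K a z ≤ Rb)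
    (f := cellOf))).trans (card_ball_le_of_rowSum hrow hμ a Rb)
  exact_mod_cast h.trans (Nat.le_ceil _)

/-- The ENDPOINT decoration built from 44's packing letters: the pair `(a,b)` carries the parameter cells of the `X`-cubes within
`R_b` of its starting cube `a`. -/
def endpointDec (cellOf : UT K → TPt d N') (X : Finset (UT K)) (Rb : ℝ) : UT K × UT K → Finset (TPt d N') :=
  fun ab => (X.filter fun z => tdist1 K ab.1 z ≤ Rb).image cellOf

omit [Fintype n] [NormedAddCommGroup E] [NormedSpace ℂ E] in
/-- Unfolding of `endpointDec`. -/
theorem mem_endpointDec {cellOf : UT K → TPt d N'} {X : Finset (UT K)} {Rb : ℝ} {ab : UT K × UT K} {j : TPt d N'} :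
    j ∈ endpointDec (d := d) (N' := N') cellOf X Rb ab ↔ ∃ z ∈ X, tdist1 K ab.1 z ≤ Rb ∧ cellOf z = j := by
  classical
  simp only [endpointDec, Finset.mem_image, Finset.mem_filter]
  constructor
  · rintro ⟨z, ⟨hz, hd⟩, he⟩; exact ⟨z, hz, hd, he⟩
  · rintro ⟨z, hz, hd, he⟩; exact ⟨z, ⟨hz, hd⟩, he⟩

/-- **THE DECORATED TAIL WITH NO NEW GEOMETRIC LETTER** (endpoint decoration): decorating the pair `(a,b)` by the parameter cells of the
`X`-cubes within `R_b` of `a` (`endpointDec`) satisfies the NEAR letter with slack `2R_b` and the TUBE letter with `P₀ = P`, `P₁ = 0`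
FROM 44's packing letter `hpack` alone — so the decorated tail asks exactly the decoration data the one-scale END already has
(`cellOf`, `P`, `R_b`), NO rate shift and NO tube count: a `BlockWalkExpansion` at window `ε`, rate `ρ_V`, constant
`e^{κ₁P}·(e^{ε·2R_b}·λc_μ²)`, σ-carrying pairs = those starting within `R_b` of `X`; `s ≡ 1` kernel `V(u)`.  (A MODEL interpolation
like the tube decoration: the jump is attached to the parameters near its start; `∂∕∂s_Δ` then sees the pairs starting near `Δ`,
exponentially localised by the tail letter.) [cite: Balaban1988RG2Cluster, p.3, (1.11) p.5, p.13; Balaban1985BackgroundPropagators, Thm 3.2 (3.48) p.398, (3.154) p.427] -/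
theorem blockWalkExpansion_tail_decorated_endpoint
    (hκ₁₀ : 0 ≤ c₀.κ₁) (hlam : 0 ≤ lamV) (hμ : 0 ≤ μ) (hκ : 0 ≤ κ) (hκε : κ + 2 * μ ≤ ρV - ε)
    (hrow : RowSum (toB6 (torusGeom K 0 0 0) 0 True) μ cμ)
    (hVan : ∀ i j, DifferentiableOn ℂ (fun u => V u i j) (ball (0 : E) R))
    (hVbd : ∀ u ∈ ball (0 : E) R, ∀ y y', blockNorm cubn cubn (V u) y y' ≤ lamV * Real.exp (-(ρV * tdist1 K y y')))
    (cellOf : UT K → TPt d N') {P : ℕ} {Rb : ℝ} (hRb : 0 ≤ Rb)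
    (hpack : ∀ a : UT K, ∃ S : Finset (TPt d N'), S.card ≤ P ∧ ∀ z, tdist1 K a z ≤ Rb → cellOf z ∈ S)
    (hκ₁ : 0 ≤ c.κ₁) (hε : 0 ≤ ε) :
    BlockWalkExpansion c cubn cubn
        (decKernel (fun (ab : UT K × UT K) (_ : TPt d N' → ℂ) u => blockCut cubn ab.1 ab.2 (V u)) (endpointDec cellOf X Rb)) X R
        ε κ (Real.exp (c.κ₁ * P) * (Real.exp (ε * (2 * Rb)) * (lamV * cμ * cμ)))
        (decTerm (fun (ab : UT K × UT K) (_ : TPt d N' → ℂ) u => blockCut cubn ab.1 ab.2 (V u)) (endpointDec cellOf X Rb))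
        {ab | (endpointDec (d := d) (N' := N') cellOf X Rb ab).Nonempty} (fun _ => Real.exp (c.κ₁ * P) * (lamV * Real.exp (ρV * (2 * Rb))))
        (fun ab y y' => tdist1 K y ab.1 + tdist1 K ab.1 ab.2 + tdist1 K ab.2 y' + 2 * Rb) ρV ∧
      (∀ u ∈ ball (0 : E) R,
        decKernel (fun (ab : UT K × UT K) (_ : TPt d N' → ℂ) u => blockCut cubn ab.1 ab.2 (V u)) (endpointDec cellOf X Rb)
          (fun _ => 1) u = V u) ∧
      ∀ ab : UT K × UT K, DomBy (toB6 (torusGeom K 0 0 0) 0 True)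
        (fun y y' => tdist1 K y ab.1 + tdist1 K ab.1 ab.2 + tdist1 K ab.2 y' + 2 * Rb) := by
  classical
  have hnear : ∀ ab : UT K × UT K, (endpointDec (d := d) (N' := N') cellOf X Rb ab).Nonempty →
      ∃ z ∈ X, tdist1 K ab.1 z + tdist1 K z ab.2 ≤ tdist1 K ab.1 ab.2 + 2 * Rb := by
    rintro ab ⟨j, hj⟩
    obtain ⟨z, hz, hd, -⟩ := mem_endpointDec.1 hj
    refine ⟨z, hz, ?_⟩
    have h1 := tdist1_triangle z ab.1 ab.2
    have h2 : tdist1 K z ab.1 = tdist1 K ab.1 z := tdist1_comm z ab.1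
    linarith
  have htube : ∀ ab : UT K × UT K, ((endpointDec (d := d) (N' := N') cellOf X Rb ab).card : ℝ) ≤ P + 0 * tdist1 K ab.1 ab.2 := by
    intro ab
    obtain ⟨S, hS, hmem⟩ := hpack ab.1
    have hsub : endpointDec (d := d) (N' := N') cellOf X Rb ab ⊆ S := by
      intro j hj
      obtain ⟨z, -, hd, rfl⟩ := mem_endpointDec.1 hj
      exact hmem z hd
    have := Finset.card_le_card hsub
    rw [zero_mul, add_zero]
    exact_mod_cast this.trans hS
  have h := blockWalkExpansion_tail_decorated (c := c) hκ₁₀ hlam hμ hκ hκε hrow hVan hVbd (endpointDec cellOf X Rb) (by positivity)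
    hnear le_rfl htube hκ₁ (by rw [mul_zero]; exact hε)
  simp only [mul_zero, sub_zero] at h
  exact h

end Decorated

end Summit.QuantumFields.BalabanUV.Gaps.D4WalkBlockTailDecorated

end
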